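import Literature.Analysis.FluidPDE.SereginSverakPressure
import Literature.Analysis.FluidPDE.SereginSverak2002PressureLowerBound
import Literature.Analysis.FluidPDE.AxisymmetricTypeIGauge
import Literature.Analysis.FluidPDE.LerayFarFieldEpsilonRegularitySlab
import Literature.Analysis.FluidPDE.CKNEpsilonRegularityHolds
import Literature.Analysis.FluidPDE.TaoQuantitativeLPTimeDeriv
import Literature.Analysis.FluidPDE.NSEssSupBound
import Literature.Analysis.FluidPDE.LerayHopfSpatialGradient
import HarnessLib

/-!
# Seregin–Šverák 2002, global form from the local form (proofs file)

Analysis/FluidPDE proofs-layer file (theorems only; no definitions, no named facts) for the named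
fact `Literature.Analysis.FluidPDE.seregin_sverak_2002` (`SereginSverakPressure.lean`; G. Seregin,
V. Šverák, *Navier–Stokes equations with lower bounds on the pressure*, Arch. Ration. Mech. Anal.
163 (2002) 65–86, main theorem, doi:10.1007/s002050200199): under a one-sided bound on the
normalised pressure (`p̃ ≥ -K`) or on the Bernoulli head (`|u|²/2 + p̃ ≤ K`) on `(0, T) × ℝ³`, a
classical Leray–Hopf solution from a rapidly decaying datum is BOUNDED on `(δ, T) × ℝ³` for every
`δ ∈ (0, T)`.

The tree vendors the same printed theorem a second time, in LOCAL form, as the named fact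
`Literature.Analysis.FluidPDE.SereginSverak2002_pressureOneSidedBound`
(`SereginSverak2002PressureLowerBound.lean`): same hypotheses, conclusion "no singular point in
`(0, T] × ℝ³`", i.e. `u` is bounded on some backward cylinder `(t₀ - r², t₀) × B(x₀, r)` at every
`(t₀, x₀)`, `0 < t₀ ≤ T` (`IsBackwardBoundedAt`) — the printed conclusion being Hölder continuity
of `v` on `ℝ³ × ]0, T]`. This file PROVES that the global form follows from the local one,

* `seregin_sverak_2002_of_pressureOneSidedBound :
    SereginSverak2002_pressureOneSidedBound → seregin_sverak_2002`,

so that the only unproved input of `seregin_sverak_2002` is the local core of the paper. The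
passage local ⇒ global is the standard one, printed for the parallel criterion of
Escauriaza–Seregin–Šverák 2003 (§3, (3.5) ⇒ (3.6): "Using scaling arguments, Lemma 2.2 and
statement (3.5), we observe that `max_{z ∈ ℝ³ × [δ, T]} |v(z)| < C₁(δ) < +∞`"; the tree's
`ess_sup_bound_of_scaled`, `NSEssSupBound.lean`) and for local Leray solutions by
Lemarié-Rieusset (2016, proof of Thm. 14.5, p. 512: far-field boundedness from the ε-regularity
criterion Thm. 14.4 and the decay of `∫∫ (|u|³ + |p|^{3/2})` at spatial infinity; the tree's
`IsSuitableWeakSolutionOn.farField_bound_of_ckn_decay`, `LerayFarFieldEpsilonRegularitySlab.lean`):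

1. **gauge** (Tao 2011, Lemma 4.1 (i), proved in the tree as `tao_pressure_normalisation_holds`):
   with `c(t) = p(t, 0) - p̃[u(t)](0)` and `q = p - c`, `q(t, ·) = p̃[u(t)]` for a.e. `t ∈ (0, T)`
   and `c` agrees a.e. on every `[0, T']`, `T' < T`, with a bounded measurable function
   (`exists_pressure_gauge_of_classical`, the argument of
   `AxisymmetricTypeIHyp.exists_pressure_gauge` for the present hypotheses);
2. **suitability**: `(u, q)` is a suitable weak solution (Caffarelli–Kohn–Nirenberg (2.1)–(2.5))
   on the open slab `(0, T) × ℝ³` (`isSuitableWeakSolutionOn_gauge_of_classical`: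
   `isSuitableWeakSolutionOn_of_contDiffOn` and `IsSuitableWeakSolutionOn.sub_pressure`);
3. **integrability**: `∫∫_{(0,T)×ℝ³} |u|³ < ∞` (Lebesgue interpolation and Sobolev slice-wise with
   the Leray–Hopf weak gradient, `lintegral_enorm_pow_three_le_of_hasWeakGradient`) and
   `∫∫_{(0,T)×ℝ³} |q|^{3/2} < ∞` (Stein's `L^{3/2}` bound for `p̃`,
   `eLpNorm_normalisedPressure_threeHalves_le`, slice-wise);
4. **far field**: the tails of these integrals give the decay hypothesis of
   `IsSuitableWeakSolutionOn.farField_bound_of_ckn_decay` (with the zero gauges), whence, by the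
   proved Thm. 14.4 (`lemarieRieusset_epsilon_regularity_holds`), `u` is essentially bounded on
   `(δ, T) × {|x| > R}`; `u` being continuous below `T`, the bound holds everywhere there;
5. **near field**: on the compact `[δ, T] × B̄(0, R)`, points with `t₀ < T` have a neighbourhood
   on which `u` is bounded by continuity, and points `(T, x₀)` have one by the local fact
   (`IsBackwardBoundedAt u T x₀`); finitely many neighbourhoods suffice.

## References

* G. Seregin, V. Šverák, ARMA 163 (2002) 65–86, main theorem (abstract). [SereginSverak2002]
* L. Escauriaza, G. Seregin, V. Šverák, Russ. Math. Surveys 58 (2003), §3, (3.5)–(3.6).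
  [EscauriazaSereginSverak2003]
* P. G. Lemarié-Rieusset, *The Navier–Stokes Problem in the 21st Century* (2016), Thm. 14.4
  (p. 505) and proof of Thm. 14.5 (p. 512). [LemarieRieusset2016]
* T. Tao, Anal. PDE 6 (2013) = arXiv:1108.1165, Lemma 4.1 (i). [Tao2011]
* L. Caffarelli, R. Kohn, L. Nirenberg, CPAM 35 (1982), §2. [CaffarelliKohnNirenberg1982]
-/

noncomputable section

open _root_.MeasureTheory _root_.TopologicalSpace _root_.Metric _root_.Filter _root_.Set
  _root_.Function
open scoped ENNReal NNReal Topology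

namespace Literature.Analysis.FluidPDE

namespace SereginSverak2002

variable {ν T : ℝ} {u : ℝ → (EuclideanSpace ℝ (Fin 3)) → (EuclideanSpace ℝ (Fin 3))}
  {p : ℝ → (EuclideanSpace ℝ (Fin 3)) → ℝ}

/-! ### Energy and the classical solution on the open interval -/

/-- **The energy bound** of a Leray–Hopf solution of the unforced system: `∫ |u(t)|² ≤ 2 E(u₀)` for
`0 ≤ t ≤ T` (energy inequality from `s = 0`). This is the tree's `IsLerayHopfOn.eEnergy_le_datum`
(`NSSerrinRegularityProofs.lean`); the short name is kept in the `SereginSverak2002` namespace for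
its users (`SereginSverakPressureTypeI`, `…LocalTypeI`). [folklore] -/
theorem eEnergy_le (hν : 0 ≤ ν) {u₀ : (EuclideanSpace ℝ (Fin 3)) → (EuclideanSpace ℝ (Fin 3))}
    (hLH : IsLerayHopfOn T ν 0 u₀ u) {t : ℝ} (ht : t ∈ Icc 0 T) :
    eEnergy (u t) ≤ ENNReal.ofReal (2 * VectorCalculus.kineticEnergy u₀) :=
  hLH.eEnergy_le_datum hν ht

/-- The classical solution restricted to the open time interval `(0, T)`. [folklore] -/
theorem classical_Ioo (hsol : IsClassicalNSSolutionOn (Ico 0 T) ν 0 u p) :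
    IsClassicalNSSolutionOn (Ioo 0 T) ν 0 u p :=
  hsol.mono Ioo_subset_Ico_self isOpen_Ioo.uniqueDiffOn

/-- `u` is continuous on `[0, T) × ℝ³`. [folklore] -/
theorem continuousOn_uncurry (hsol : IsClassicalNSSolutionOn (Ico 0 T) ν 0 u p) :
    ContinuousOn (uncurry u) (Ico 0 T ×ˢ (univ : Set (EuclideanSpace ℝ (Fin 3)))) :=
  hsol.smooth_velocity.continuousOn

/-! ### Step 1: the pressure gauge (Tao 2011, Lemma 4.1 (i)) -/

/-- **The pressure gauge.** For a classical solution on `[0, T)` which is Leray–Hopf on `[0, T)`,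
with `c(t) = p(t, 0) − p̃[u(t)](0)`: (i) `p(t, ·) − c(t) = p̃[u(t)]` for a.e. `t ∈ (0, T)`;
(ii) for every `T' < T`, `c` agrees a.e. on `[0, T']` with a bounded measurable function
(Tao 2011, Lemma 4.1 (i) on the closed slab `[0, T']`, the proved
`tao_pressure_normalisation_holds`; the argument of `AxisymmetricTypeIHyp.exists_pressure_gauge`).
[cite: Tao2011, Lemma 4.1 (i)] -/
theorem exists_pressure_gauge_of_classical (hν : 0 < ν) (hT : 0 < T)
    (hsol : IsClassicalNSSolutionOn (Ico 0 T) ν 0 u p) (hLH : IsLerayHopfOn T ν 0 (u 0) u) :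
    (∀ᵐ t ∂(volume.restrict (Ioo 0 T)), ∀ x,
        p t x - (p t 0 - normalisedPressure (u t) 0) = normalisedPressure (u t) x) ∧
      ∀ T' < T, ∃ (C : ℝ → ℝ) (M : ℝ), Measurable C ∧ (∀ t, |C t| ≤ M) ∧
        ∀ᵐ t ∂(volume.restrict (Icc 0 T')), p t 0 - normalisedPressure (u t) 0 = C t := by
  -- Tao's normalisation on each closed slab `[0, T']`, `0 < T' < T`
  have key : ∀ T' ∈ Ioo 0 T, ∃ (C : ℝ → ℝ) (M : ℝ), Measurable C ∧ (∀ t, |C t| ≤ M) ∧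
      ∀ᵐ t ∂(volume.restrict (Icc 0 T')), ∀ x, p t x = normalisedPressure (u t) x + C t := by
    intro T' hT'
    have hsol' : IsClassicalNSSolutionOn (Icc 0 T') ν 0 u p :=
      hsol.mono (Icc_subset_Ico_right hT'.2) (uniqueDiffOn_Icc hT'.1)
    have hEn : ∃ Cₑ : ℝ≥0∞, Cₑ < ⊤ ∧ ∀ t ∈ Icc 0 T', ∫⁻ x, ‖u t x‖ₑ ^ 2 ≤ Cₑ :=
      ⟨ENNReal.ofReal (2 * VectorCalculus.kineticEnergy (u 0)), ENNReal.ofReal_lt_top,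
        fun t ht => eEnergy_le hν.le hLH ⟨ht.1, ht.2.trans hT'.2.le⟩⟩
    obtain ⟨C, hCm, ⟨M, hM⟩, hae⟩ := tao_pressure_normalisation_holds ν T' hν hT'.1 u p hsol' hEn
    -- make the bound global by cutting `C` off outside `[0, T']`
    refine ⟨(Icc 0 T').indicator C, max M 0, hCm.indicator measurableSet_Icc, fun t => ?_, ?_⟩
    · by_cases ht : t ∈ Icc 0 T'
      · rw [indicator_of_mem ht]; exact (hM t ht).trans (le_max_left _ _)
      · rw [indicator_of_notMem ht, abs_zero]; exact le_max_right _ _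
    · filter_upwards [hae, ae_restrict_mem measurableSet_Icc] with t ht htI x
      rw [indicator_of_mem htI]
      exact ht x
  refine ⟨?_, fun T' hT'T => ?_⟩
  · -- (i) a.e. on `(0, T)` through the cover by `(0, T − T/(n+2)]`
    rw [← iUnion_Ioc_sub_div_eq_Ioo hT, ae_restrict_iUnion_iff]
    intro n
    have hT'mem : T - T / ((n : ℝ) + 2) ∈ Ioo 0 T := by
      constructor
      · have h1 : T / ((n : ℝ) + 2) < T := by
          rw [div_lt_iff₀ (by positivity)]; nlinarith
        linarith
      · have : 0 < T / ((n : ℝ) + 2) := by positivity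
        linarith
    obtain ⟨C, M, -, -, hae⟩ := key _ hT'mem
    refine ae_restrict_of_ae_restrict_of_subset Ioc_subset_Icc_self ?_
    filter_upwards [hae] with t ht x
    rw [ht x, ht 0]
    ring
  · -- (ii) on `[0, T']`
    rcases le_or_gt T' 0 with hT'0 | hT'0
    · refine ⟨0, 0, measurable_const, fun t => by simp, ?_⟩
      have hnull : volume (Icc (0 : ℝ) T') = 0 := by
        rw [Real.volume_Icc, sub_zero, ENNReal.ofReal_eq_zero]
        exact hT'0
      rw [Measure.restrict_eq_zero.2 hnull, ae_zero]
      exact Filter.eventually_bot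
    · obtain ⟨C, M, hCm, hCb, hae⟩ := key T' ⟨hT'0, hT'T⟩
      refine ⟨C, M, hCm, hCb, ?_⟩
      filter_upwards [hae] with t ht
      rw [ht 0]
      ring

/-! ### Step 2: suitability of the gauged pair on every open region below the final time -/

/-- **`(u, p)` is a suitable weak solution on every open region below the final time** (the
accepted local notion `IsSuitableWeakSolutionOn`; CKN 1982 (2.1)–(2.5) with equality in (2.5)
for smooth solutions, `isSuitableWeakSolutionOn_of_contDiffOn`).
[cite: CaffarelliKohnNirenberg1982, §2 (2.1)–(2.5)] -/
theorem isSuitableWeakSolutionOn_of_classical (hsol : IsClassicalNSSolutionOn (Ico 0 T) ν 0 u p)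
    (Q : Opens (ℝ × (EuclideanSpace ℝ (Fin 3))))
    (hQ : (Q : Set (ℝ × (EuclideanSpace ℝ (Fin 3)))) ⊆ Ioo 0 T ×ˢ univ) :
    IsSuitableWeakSolutionOn Q ν 0 u p := by
  have hcl := classical_Ioo hsol
  refine isSuitableWeakSolutionOn_of_contDiffOn isOpen_Ioo hQ
    (hcl.smooth_velocity.of_le (by norm_cast)) (hcl.smooth_pressure.of_le (by norm_cast))
    continuousOn_const (fun t ht x => ?_) hcl.divFree
  rw [← AxisymmetricTypeIHyp.timeDerivWithin_Ioo_eq ht x]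
  exact hcl.momentum t ht x

/-- **`(u, p − c)` is a suitable weak solution on every open region below the final time**, for
the gauge `c(t) = p(t, 0) − p̃[u(t)](0)` (`IsSuitableWeakSolutionOn.sub_pressure`: `c` is locally
integrable and locally `L^{3/2}` on `Q`, every compact subset of `Q` staying below some
`T' < T`, where `c` agrees a.e. with a bounded measurable function).
[cite: CaffarelliKohnNirenberg1982, §2] -/
theorem isSuitableWeakSolutionOn_gauge_of_classical (hν : 0 < ν) (hT : 0 < T)
    (hsol : IsClassicalNSSolutionOn (Ico 0 T) ν 0 u p) (hLH : IsLerayHopfOn T ν 0 (u 0) u)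
    (Q : Opens (ℝ × (EuclideanSpace ℝ (Fin 3))))
    (hQ : (Q : Set (ℝ × (EuclideanSpace ℝ (Fin 3)))) ⊆ Ioo 0 T ×ˢ univ) :
    IsSuitableWeakSolutionOn Q ν 0 u fun t x => p t x - (p t 0 - normalisedPressure (u t) 0) := by
  obtain ⟨-, hloc⟩ := exists_pressure_gauge_of_classical hν hT hsol hLH
  set c : ℝ → ℝ := fun t => p t 0 - normalisedPressure (u t) 0 with hc
  have hpiece : ∀ K ⊆ (Q : Set (ℝ × (EuclideanSpace ℝ (Fin 3)))), IsCompact K →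
      IntegrableOn (fun z : ℝ × (EuclideanSpace ℝ (Fin 3)) => c z.1) K volume ∧
        ∫⁻ z in K, ‖c z.1‖ₑ ^ (3 / 2 : ℝ) < ∞ := by
    intro K hKQ hK
    obtain ⟨T', hT', hKsub⟩ := exists_subset_Icc_prod_of_isCompact hK (hKQ.trans hQ) hT
    obtain ⟨C, M, hCm, hCb, hae⟩ := hloc T' hT'.2
    exact integrableOn_and_lintegral_lt_top_of_ae_eq hCm hCb hae hK hKsub
  have hli : LocallyIntegrableOn (fun z : ℝ × (EuclideanSpace ℝ (Fin 3)) => c z.1)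
      (Q : Set (ℝ × (EuclideanSpace ℝ (Fin 3)))) volume :=
    (locallyIntegrableOn_iff Q.isOpen.isLocallyClosed).2 fun K hKQ hK => (hpiece K hKQ hK).1
  exact (isSuitableWeakSolutionOn_of_classical hsol Q hQ).sub_pressure hli
    fun K hKQ hK => (hpiece K hKQ hK).2


/-! ### Step 3: integrability on the slab `(0, T) × ℝ³` -/

/-- `∫ |f|^{3/2} = ‖f‖_{L^{3/2}}^{3/2}`. [folklore] -/
private theorem lintegral_rpow_threeHalves_eq {α : Type*} [MeasurableSpace α] (μ : Measure α)
    (f : α → ℝ) :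
    ∫⁻ x, ‖f x‖ₑ ^ (3 / 2 : ℝ) ∂μ = eLpNorm f (3 / 2 : ℝ≥0∞) μ ^ (3 / 2 : ℝ) := by
  have h32 : (3 / 2 : ℝ≥0∞) ≠ 0 := by norm_num
  have h32' : (3 / 2 : ℝ≥0∞) ≠ ⊤ := by
    rw [ENNReal.div_eq_inv_mul]; exact ENNReal.mul_ne_top (by simp) (by simp)
  have e : (3 / 2 : ℝ≥0∞).toReal = 3 / 2 := by rw [ENNReal.toReal_div]; norm_num
  rw [eLpNorm_eq_lintegral_rpow_enorm_toReal h32 h32', e, ← ENNReal.rpow_mul]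
  norm_num

/-- `∫ |f|³ = ‖f‖_{L³}³` (natural-number power on the left). [folklore] -/
private theorem lintegral_pow_three_eq {α : Type*} [MeasurableSpace α] {G : Type*}
    [NormedAddCommGroup G] (μ : Measure α) (f : α → G) :
    ∫⁻ x, ‖f x‖ₑ ^ (3 : ℕ) ∂μ = eLpNorm f 3 μ ^ (3 : ℝ) := by
  rw [eLpNorm_eq_lintegral_rpow_enorm_toReal (by norm_num) (by norm_num), ENNReal.toReal_ofNat,
    ← ENNReal.rpow_mul]
  have e : ∀ x, ‖f x‖ₑ ^ (3 : ℕ) = ‖f x‖ₑ ^ (3 : ℝ) := fun x => by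
    rw [← ENNReal.rpow_natCast]; norm_num
  simp_rw [e]
  norm_num

/-- **The `L³` slice bound through a weak gradient** (Lebesgue interpolation
`‖v‖₃ ≤ ‖v‖₂^{1/2}‖v‖₆^{1/2}` and the Sobolev inequality `‖v‖₆ ≤ K ‖∇v‖₂` on `ℝ³`, the latter for
weak gradients, `eLpNorm_six_le_frobenius_of_hasWeakGradient`): for `v ∈ L²` with `∫|v|² ≤ A` and
weak gradient `G`, `∫ |v|³ ≤ A^{3/4} K^{3/2} (∫|G|²)^{3/4}` (the argument of
`lintegral_enorm_pow_three_le`, `TaoFiniteEnergyLerayHopf.lean`). [folklore] -/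
theorem lintegral_enorm_pow_three_le_of_hasWeakGradient
    {v : (EuclideanSpace ℝ (Fin 3)) → (EuclideanSpace ℝ (Fin 3))}
    {G : (EuclideanSpace ℝ (Fin 3)) → (EuclideanSpace ℝ (Fin 3)) →L[ℝ] (EuclideanSpace ℝ (Fin 3))}
    (hmem : MemLp v 2 volume) (hG : HasWeakGradient v G) {A : ℝ≥0∞}
    (hA : ∫⁻ x, ‖v x‖ₑ ^ 2 ≤ A) :
    ∫⁻ x, ‖v x‖ₑ ^ (3 : ℕ) ≤
      A ^ (3 / 4 : ℝ) *
        ((SNormLESNormFDerivOfEqConst (EuclideanSpace ℝ (Fin 3))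
            (volume : Measure (EuclideanSpace ℝ (Fin 3))) 2 : ℝ≥0∞) ^ (3 / 2 : ℝ) *
          (∫⁻ x, ENNReal.ofReal (frobeniusNormSq (G x))) ^ (3 / 4 : ℝ)) := by
  set K : ℝ≥0∞ :=
    (SNormLESNormFDerivOfEqConst (EuclideanSpace ℝ (Fin 3))
      (volume : Measure (EuclideanSpace ℝ (Fin 3))) 2 : ℝ≥0∞) with hK
  set D : ℝ≥0∞ := ∫⁻ x, ENNReal.ofReal (frobeniusNormSq (G x)) with hD
  have hmeas :
      AEMeasurable (fun x => ‖v x‖ₑ ^ (3 / 2 : ℝ)) (volume : Measure (EuclideanSpace ℝ (Fin 3))) :=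
    hmem.1.enorm.pow_const _
  -- Hölder with exponents `4/3` and `4`
  have hpq : (4 / 3 : ℝ).HolderConjugate 4 := by rw [Real.holderConjugate_iff]; norm_num
  have hH :=
    ENNReal.lintegral_mul_le_Lp_mul_Lq (volume : Measure (EuclideanSpace ℝ (Fin 3))) hpq hmeas hmeas
  have hprod : ∀ x, ((fun x => ‖v x‖ₑ ^ (3 / 2 : ℝ)) * fun x => ‖v x‖ₑ ^ (3 / 2 : ℝ)) x =
      ‖v x‖ₑ ^ (3 : ℕ) := by
    intro x
    simp only [Pi.mul_apply]
    rw [← ENNReal.rpow_add_of_nonneg _ _ (by norm_num) (by norm_num)]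
    norm_num
  have h1 : ∀ x, (‖v x‖ₑ ^ (3 / 2 : ℝ)) ^ (4 / 3 : ℝ) = ‖v x‖ₑ ^ 2 := by
    intro x
    rw [← ENNReal.rpow_mul]; norm_num
  have h2 : ∀ x, (‖v x‖ₑ ^ (3 / 2 : ℝ)) ^ (4 : ℝ) = ‖v x‖ₑ ^ (6 : ℝ) := by
    intro x
    rw [← ENNReal.rpow_mul]; norm_num
  simp only [hprod, h1, h2] at hH
  -- the `L⁶` factor by Sobolev
  have hS := eLpNorm_six_le_frobenius_of_hasWeakGradient (F' := (EuclideanSpace ℝ (Fin 3)))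
    finrank_euclideanSpace_fin hmem hG
  have h6 : ∫⁻ x, ‖v x‖ₑ ^ (6 : ℝ) = eLpNorm v 6 volume ^ (6 : ℝ) := by
    rw [eLpNorm_eq_lintegral_rpow_enorm_toReal (by norm_num) (by norm_num)]
    rw [← ENNReal.rpow_mul]
    norm_num
  have hexp : (1 / (4 / 3 : ℝ)) = 3 / 4 := by norm_num
  rw [hexp] at hH
  have hA' : (∫⁻ x, ‖v x‖ₑ ^ 2) ^ (3 / 4 : ℝ) ≤ A ^ (3 / 4 : ℝ) :=
    ENNReal.rpow_le_rpow hA (by norm_num)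
  have h6' : (∫⁻ x, ‖v x‖ₑ ^ (6 : ℝ)) ^ (1 / (4 : ℝ)) ≤
      ((K * D ^ (1 / 2 : ℝ)) ^ (6 : ℝ)) ^ (1 / (4 : ℝ)) := by
    rw [h6]
    exact ENNReal.rpow_le_rpow (ENNReal.rpow_le_rpow hS (by norm_num)) (by norm_num)
  have hKD : ((K * D ^ (1 / 2 : ℝ)) ^ (6 : ℝ)) ^ (1 / (4 : ℝ)) =
      K ^ (3 / 2 : ℝ) * D ^ (3 / 4 : ℝ) := by
    rw [← ENNReal.rpow_mul, ENNReal.mul_rpow_of_nonneg _ _ (by norm_num), ← ENNReal.rpow_mul]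
    norm_num
  calc ∫⁻ x, ‖v x‖ₑ ^ (3 : ℕ)
      ≤ (∫⁻ x, ‖v x‖ₑ ^ 2) ^ (3 / 4 : ℝ) * (∫⁻ x, ‖v x‖ₑ ^ (6 : ℝ)) ^ (1 / (4 : ℝ)) := hH
    _ ≤ A ^ (3 / 4 : ℝ) * ((K * D ^ (1 / 2 : ℝ)) ^ (6 : ℝ)) ^ (1 / (4 : ℝ)) := mul_le_mul' hA' h6'
    _ = A ^ (3 / 4 : ℝ) * (K ^ (3 / 2 : ℝ) * D ^ (3 / 4 : ℝ)) := by rw [hKD]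

/-- **Slice-wise cubic integrability, a.e. in time**: for a classical solution on `[0, T)` which
is Leray–Hopf on `[0, T)` there are a finite constant `c` and a weak spatial gradient `G` of
finite dissipation with `∫ |u(t)|³ ≤ c (1 + ∫ |G(t)|²)` for a.e. `t ∈ (0, T)`. [folklore] -/
theorem exists_ae_lintegral_enorm_pow_three_le (hν : 0 < ν)
    (hLH : IsLerayHopfOn T ν 0 (u 0) u) :
    ∃ (c : ℝ≥0∞)
      (G : ℝ → (EuclideanSpace ℝ (Fin 3)) → (EuclideanSpace ℝ (Fin 3)) →L[ℝ]
        (EuclideanSpace ℝ (Fin 3))),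
      c ≠ ⊤ ∧
      (∫⁻ t in Ioo 0 T, ∫⁻ x, ENNReal.ofReal (frobeniusNormSq (G t x)) < ∞) ∧
      ∀ᵐ t ∂(volume.restrict (Ioo 0 T)),
        ∫⁻ x, ‖u t x‖ₑ ^ (3 : ℕ) ≤ c * (1 + ∫⁻ x, ENNReal.ofReal (frobeniusNormSq (G t x))) := by
  obtain ⟨G, -, hG, -, hint⟩ := hLH.exists_hasWeakSpatialGradientOn
  set A : ℝ≥0∞ := ENNReal.ofReal (2 * VectorCalculus.kineticEnergy (u 0)) with hA
  set K : ℝ≥0∞ :=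
    (SNormLESNormFDerivOfEqConst (EuclideanSpace ℝ (Fin 3))
      (volume : Measure (EuclideanSpace ℝ (Fin 3))) 2 : ℝ≥0∞) with hK
  set c : ℝ≥0∞ := A ^ (3 / 4 : ℝ) * K ^ (3 / 2 : ℝ) with hc
  have hct : c ≠ ⊤ := ENNReal.mul_ne_top (ENNReal.rpow_ne_top_of_nonneg (by norm_num)
    ENNReal.ofReal_ne_top) (ENNReal.rpow_ne_top_of_nonneg (by norm_num) ENNReal.coe_ne_top)
  refine ⟨c, G, hct, hint, ?_⟩
  filter_upwards [hG, ae_restrict_mem measurableSet_Ioo] with t ht htI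
  have htc : t ∈ Icc 0 T := ⟨htI.1.le, htI.2.le⟩
  have hmem : MemLp (u t) 2 volume := hLH.memLp t htc
  have hAt : ∫⁻ x, ‖u t x‖ₑ ^ 2 ≤ A := eEnergy_le hν.le hLH htc
  refine (lintegral_enorm_pow_three_le_of_hasWeakGradient hmem ht hAt).trans ?_
  rw [hc, mul_assoc]
  gcongr
  exact ENNReal.rpow_three_quarters_le_one_add _

/-- **Tonelli's inequality on a slab**: `∫∫_{S × ℝ³} F ≤ ∫_S ∫_{ℝ³} F` (no measurability needed,
`lintegral_prod_le`). [folklore] -/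
theorem lintegral_slab_le_lintegral_lintegral (S : Set ℝ)
    (F : ℝ × (EuclideanSpace ℝ (Fin 3)) → ℝ≥0∞) :
    ∫⁻ z in S ×ˢ (univ : Set (EuclideanSpace ℝ (Fin 3))), F z ≤ ∫⁻ t in S, ∫⁻ x, F (t, x) := by
  calc ∫⁻ z in S ×ˢ (univ : Set (EuclideanSpace ℝ (Fin 3))), F z
      = ∫⁻ z, F z ∂(((volume : Measure ℝ).restrict S).prod
          (volume : Measure (EuclideanSpace ℝ (Fin 3)))) := by
        rw [restrict_prod_univ_eq]
    _ ≤ ∫⁻ t, ∫⁻ x, F (t, x) ∂(volume : Measure (EuclideanSpace ℝ (Fin 3)))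
          ∂((volume : Measure ℝ).restrict S) :=
        lintegral_prod_le _

/-- **`u ∈ L³((0, T) × ℝ³)`** for a classical solution on `[0, T)` which is Leray–Hopf on
`[0, T)` (integrate the slice bound: `∫₀ᵀ∫|u|³ ≤ c (T + ∫₀ᵀ∫|∇u|²) < ∞`). [folklore] -/
theorem lintegral_slab_enorm_pow_three_lt_top (hν : 0 < ν) (hLH : IsLerayHopfOn T ν 0 (u 0) u) :
    ∫⁻ z in Ioo 0 T ×ˢ (univ : Set (EuclideanSpace ℝ (Fin 3))), ‖u z.1 z.2‖ₑ ^ (3 : ℕ) < ∞ := by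
  obtain ⟨c, G, hct, hint, hslice⟩ := exists_ae_lintegral_enorm_pow_three_le hν hLH
  refine (lintegral_slab_le_lintegral_lintegral _ _).trans_lt ?_
  calc ∫⁻ t in Ioo 0 T, ∫⁻ x, ‖u t x‖ₑ ^ (3 : ℕ)
      ≤ ∫⁻ t in Ioo 0 T, c * (1 + ∫⁻ x, ENNReal.ofReal (frobeniusNormSq (G t x))) :=
        lintegral_mono_ae hslice
    _ = c * (volume (Ioo 0 T) +
          ∫⁻ t in Ioo 0 T, ∫⁻ x, ENNReal.ofReal (frobeniusNormSq (G t x))) := by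
        rw [lintegral_const_mul' _ _ hct, lintegral_add_left measurable_const, setLIntegral_const,
          one_mul]
    _ < ∞ := by
        refine ENNReal.mul_lt_top hct.lt_top (ENNReal.add_lt_top.2 ⟨?_, hint⟩)
        rw [Real.volume_Ioo]; exact ENNReal.ofReal_lt_top

/-- **The `L^{3/2}` slice bound for the normalised pressure in `lintegral` form**: for a smooth
field `w ∈ L²(ℝ³)`, `∫ |p̃[w]|^{3/2} ≤ C_{3/2}^{3/2} ∫ |w|³` (Stein's bound
`eLpNorm_normalisedPressure_threeHalves_le`). [cite: Stein1971, Ch. II §4.2 Thm. 3] -/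
theorem lintegral_normalisedPressure_rpow_le
    {w : (EuclideanSpace ℝ (Fin 3)) → (EuclideanSpace ℝ (Fin 3))}
    (hw : ContDiff ℝ (⊤ : ℕ∞) w)
    (hL2 : Integrable fun y => ‖w y‖ ^ 2) :
    ∫⁻ x, ‖normalisedPressure w x‖ₑ ^ (3 / 2 : ℝ) ≤
      (steinConstThreeHalves : ℝ≥0∞) ^ (3 / 2 : ℝ) * ∫⁻ x, ‖w x‖ₑ ^ (3 : ℕ) := by
  have key := eLpNorm_normalisedPressure_threeHalves_le hw hL2
  have hpos : (0 : ℝ) ≤ 3 / 2 := by norm_num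
  have key' := ENNReal.rpow_le_rpow key hpos
  rw [ENNReal.mul_rpow_of_nonneg _ _ hpos] at key'
  rw [lintegral_rpow_threeHalves_eq, lintegral_pow_three_eq]
  refine key'.trans (le_of_eq ?_)
  congr 1
  rw [← ENNReal.rpow_natCast, ← ENNReal.rpow_mul]
  norm_num

/-- **`q = p − c ∈ L^{3/2}((0, T) × ℝ³)`** for the gauged pressure of a classical solution on
`[0, T)` which is Leray–Hopf on `[0, T)` (`q(t, ·) = p̃[u(t)]` for a.e. `t`, Stein's `L^{3/2}`
bound slice-wise, and `u ∈ L³` of the slab). [folklore] -/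
theorem lintegral_slab_gauged_pressure_lt_top (hν : 0 < ν) (hT : 0 < T)
    (hsol : IsClassicalNSSolutionOn (Ico 0 T) ν 0 u p) (hLH : IsLerayHopfOn T ν 0 (u 0) u) :
    ∫⁻ z in Ioo 0 T ×ˢ (univ : Set (EuclideanSpace ℝ (Fin 3))),
      ‖p z.1 z.2 - (p z.1 0 - normalisedPressure (u z.1) 0)‖ₑ ^ (3 / 2 : ℝ) < ∞ := by
  obtain ⟨hgauge, -⟩ := exists_pressure_gauge_of_classical hν hT hsol hLH
  obtain ⟨c, G, hct, hint, hslice⟩ := exists_ae_lintegral_enorm_pow_three_le hν hLH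
  set C₀ : ℝ≥0∞ := (steinConstThreeHalves : ℝ≥0∞) ^ (3 / 2 : ℝ) with hC₀
  have hC₀t : C₀ ≠ ⊤ := ENNReal.rpow_ne_top_of_nonneg (by norm_num) ENNReal.coe_ne_top
  have hslice' : ∀ᵐ t ∂(volume.restrict (Ioo 0 T)),
      ∫⁻ x, ‖p t x - (p t 0 - normalisedPressure (u t) 0)‖ₑ ^ (3 / 2 : ℝ) ≤
        C₀ * c * (1 + ∫⁻ x, ENNReal.ofReal (frobeniusNormSq (G t x))) := by
    filter_upwards [hgauge, hslice, ae_restrict_mem measurableSet_Ioo] with t ht h3 htI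
    have hsm : ContDiff ℝ (⊤ : ℕ∞) (u t) := hsol.contDiff_velocity ⟨htI.1.le, htI.2⟩
    have hL2 : Integrable fun y => ‖u t y‖ ^ 2 :=
      (hLH.memLp t ⟨htI.1.le, htI.2.le⟩).integrable_norm_pow two_ne_zero
    calc ∫⁻ x, ‖p t x - (p t 0 - normalisedPressure (u t) 0)‖ₑ ^ (3 / 2 : ℝ)
        = ∫⁻ x, ‖normalisedPressure (u t) x‖ₑ ^ (3 / 2 : ℝ) := by simp_rw [ht]
      _ ≤ C₀ * ∫⁻ x, ‖u t x‖ₑ ^ (3 : ℕ) := lintegral_normalisedPressure_rpow_le hsm hL2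
      _ ≤ C₀ * (c * (1 + ∫⁻ x, ENNReal.ofReal (frobeniusNormSq (G t x)))) := by gcongr
      _ = C₀ * c * (1 + ∫⁻ x, ENNReal.ofReal (frobeniusNormSq (G t x))) := by rw [mul_assoc]
  refine (lintegral_slab_le_lintegral_lintegral _ _).trans_lt ?_
  have hCc : C₀ * c ≠ ⊤ := ENNReal.mul_ne_top hC₀t hct
  calc ∫⁻ t in Ioo 0 T, ∫⁻ x, ‖p t x - (p t 0 - normalisedPressure (u t) 0)‖ₑ ^ (3 / 2 : ℝ)
      ≤ ∫⁻ t in Ioo 0 T, C₀ * c * (1 + ∫⁻ x, ENNReal.ofReal (frobeniusNormSq (G t x))) :=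
        lintegral_mono_ae hslice'
    _ = C₀ * c * (volume (Ioo 0 T) +
          ∫⁻ t in Ioo 0 T, ∫⁻ x, ENNReal.ofReal (frobeniusNormSq (G t x))) := by
        rw [lintegral_const_mul' _ _ hCc, lintegral_add_left measurable_const, setLIntegral_const,
          one_mul]
    _ < ∞ := by
        refine ENNReal.mul_lt_top hCc.lt_top (ENNReal.add_lt_top.2 ⟨?_, hint⟩)
        rw [Real.volume_Ioo]; exact ENNReal.ofReal_lt_top

/-! ### Step 4: the far field -/

/-- **An essential bound of a continuous function on an open set holds everywhere** (the
exceptional set would contain a nonempty open set, of positive measure). [folklore] -/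
theorem norm_le_of_ae_restrict_of_continuousOn {X : Type*} [TopologicalSpace X]
    [MeasurableSpace X] [OpensMeasurableSpace X] {μ : Measure X} [μ.IsOpenPosMeasure]
    {F : Type*} [NormedAddCommGroup F] {f : X → F} {V : Set X} (hV : IsOpen V)
    (hf : ContinuousOn f V) {M : ℝ} (h : ∀ᵐ z ∂(μ.restrict V), ‖f z‖ ≤ M) :
    ∀ z ∈ V, ‖f z‖ ≤ M := by
  by_contra hcon
  push Not at hcon
  obtain ⟨z, hzV, hz⟩ := hcon
  set W : Set X := V ∩ (fun w => ‖f w‖) ⁻¹' Ioi M with hW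
  have hWo : IsOpen W := hf.norm.isOpen_inter_preimage hV isOpen_Ioi
  have hWpos : 0 < μ W := hWo.measure_pos μ ⟨z, hzV, hz⟩
  rw [ae_restrict_iff' hV.measurableSet, ae_iff] at h
  have hsub : W ⊆ {w | ¬(w ∈ V → ‖f w‖ ≤ M)} := by
    rintro w ⟨hwV, hw⟩
    simp only [mem_setOf_eq, Classical.not_imp, not_le]
    exact ⟨hwV, hw⟩
  exact (lt_irrefl (0 : ℝ≥0∞)) (hWpos.trans_le ((measure_mono hsub).trans h.le))

/-- **The far-field bound** (Lemarié-Rieusset 2016, proof of Thm. 14.5, p. 512, through the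
tree's `IsSuitableWeakSolutionOn.farField_bound_of_ckn_decay` and the proved Thm. 14.4): for a
classical solution on `[0, T)` which is Leray–Hopf on `[0, T)` and every `δ > 0` there are `R`,
`M` with `|u(t, x)| ≤ M` for `δ < t < T`, `|x| > R`. The decay of
`∫₀ᵀ∫_{B(x₀, 3/2)} (|u|³ + |q|^{3/2})` as `|x₀| → ∞` is the tail of a finite integral over the
slab (`exists_radius_tail_lt`); the essential bound is an everywhere bound by continuity.
[cite: LemarieRieusset2016, proof of Thm. 14.5 (p. 512) with Thm. 14.4 (p. 505)] -/
theorem farField_bound (hν : 0 < ν) (hT : 0 < T)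
    (hsol : IsClassicalNSSolutionOn (Ico 0 T) ν 0 u p) (hLH : IsLerayHopfOn T ν 0 (u 0) u)
    {δ : ℝ} (hδ : 0 < δ) :
    ∃ R M : ℝ, ∀ t ∈ Ioo δ T, ∀ x : (EuclideanSpace ℝ (Fin 3)), R < ‖x‖ → ‖u t x‖ ≤ M := by
  set q : ℝ → (EuclideanSpace ℝ (Fin 3)) → ℝ :=
    fun t x => p t x - (p t 0 - normalisedPressure (u t) 0) with hq
  -- the gauged suitable weak solution on the open slab
  have hsw :
      IsSuitableWeakSolutionOn (slab (EuclideanSpace ℝ (Fin 3)) (Ioo 0 T) isOpen_Ioo) ν 0 u q :=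
    isSuitableWeakSolutionOn_gauge_of_classical hν hT hsol hLH _ (coe_slab _ _).subset
  -- the Caffarelli–Kohn–Nirenberg density is integrable over the slab
  set F : ℝ × (EuclideanSpace ℝ (Fin 3)) → ℝ≥0∞ :=
    fun z => ‖u z.1 z.2‖ₑ ^ (3 : ℕ) + ‖q z.1 z.2‖ₑ ^ (3 / 2 : ℝ) with hF
  have hmeas : AEMeasurable (fun z : ℝ × (EuclideanSpace ℝ (Fin 3)) => ‖u z.1 z.2‖ₑ ^ (3 : ℕ))
      ((volume : Measure (ℝ × (EuclideanSpace ℝ (Fin 3)))).restrict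
        (Ioo 0 T ×ˢ (univ : Set (EuclideanSpace ℝ (Fin 3))))) := by
    have hc : ContinuousOn (uncurry u) (Ioo 0 T ×ˢ (univ : Set (EuclideanSpace ℝ (Fin 3)))) :=
      (continuousOn_uncurry hsol).mono (prod_mono Ioo_subset_Ico_self Subset.rfl)
    exact ((hc.aemeasurable (measurableSet_Ioo.prod MeasurableSet.univ)).enorm.pow_const 3)
  have hFint : ∫⁻ z in Ioo 0 T ×ˢ (univ : Set (EuclideanSpace ℝ (Fin 3))), F z < ∞ := by
    rw [hF, lintegral_add_left' hmeas]
    exact ENNReal.add_lt_top.2 ⟨lintegral_slab_enorm_pow_three_lt_top hν hLH,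
      lintegral_slab_gauged_pressure_lt_top hν hT hsol hLH⟩
  -- hence its box integrals decay at spatial infinity
  have hdecay : Tendsto (fun x₀ : (EuclideanSpace ℝ (Fin 3)) =>
      ∫⁻ z in Ioo 0 T ×ˢ ball x₀ (3 / 2),
        (‖u z.1 z.2‖ₑ ^ (3 : ℕ) +
          ‖q z.1 z.2 - (fun (_ : (EuclideanSpace ℝ (Fin 3))) (_ : ℝ) => (0 : ℝ)) x₀ z.1‖ₑ ^
            (3 / 2 : ℝ))) (cocompact (EuclideanSpace ℝ (Fin 3))) (𝓝 0) := by
    simp only [sub_zero]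
    refine ENNReal.tendsto_nhds_zero.2 fun η hη => ?_
    obtain ⟨n, hn⟩ := exists_radius_tail_lt hFint hη
    rw [← Metric.cobounded_eq_cocompact]
    refine
      (Metric.hasBasis_cobounded_compl_closedBall (0 : (EuclideanSpace ℝ (Fin 3)))).eventually_iff.2
      ⟨(n : ℝ) + 3 / 2, trivial, fun x₀ hx₀ => ?_⟩
    rw [mem_compl_iff, mem_closedBall, dist_zero_right, not_le] at hx₀
    have hsub : Ioo 0 T ×ˢ ball x₀ (3 / 2) ⊆
        (Ioo 0 T ×ˢ (univ : Set (EuclideanSpace ℝ (Fin 3)))) ∩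
          {z : ℝ × (EuclideanSpace ℝ (Fin 3)) | (n : ℝ) ≤ ‖z.2‖} := by
      rintro ⟨t, y⟩ ⟨ht, hy⟩
      refine ⟨⟨ht, mem_univ _⟩, ?_⟩
      rw [mem_ball, dist_eq_norm] at hy
      show (n : ℝ) ≤ ‖y‖
      have h1 := norm_sub_norm_le x₀ y
      rw [← norm_neg (x₀ - y), neg_sub] at h1
      linarith
    exact ((lintegral_mono_set hsub).trans hn.le)
  -- Thm. 14.4 through the far-field theorem of the slab
  obtain ⟨R, hR⟩ := hsw.farField_bound_of_ckn_decay lemarieRieusset_epsilon_regularity_holds hν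
    (c := fun (_ : (EuclideanSpace ℝ (Fin 3))) (_ : ℝ) => (0 : ℝ)) (fun _ => MemLp.zero) hdecay
    hδ le_rfl
  -- from the essential bound to a pointwise bound on the open far region
  set V : Set (ℝ × (EuclideanSpace ℝ (Fin 3))) :=
    Ioo δ T ×ˢ (closedBall (0 : (EuclideanSpace ℝ (Fin 3))) R)ᶜ with hV
  have hVo : IsOpen V := isOpen_Ioo.prod isClosed_closedBall.isOpen_compl
  set M : ℝ :=
    (eLpNorm (uncurry u) ∞
      ((volume : Measure (ℝ × (EuclideanSpace ℝ (Fin 3)))).restrict V)).toReal with hM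
  have hae : ∀ᵐ z ∂((volume : Measure (ℝ × (EuclideanSpace ℝ (Fin 3)))).restrict V),
      ‖uncurry u z‖ ≤ M := by
    have h1 :=
      ae_le_eLpNormEssSup (μ := (volume : Measure (ℝ × (EuclideanSpace ℝ (Fin 3)))).restrict V)
        (f := uncurry u)
    filter_upwards [h1] with z hz
    rw [hM, eLpNorm_exponent_top]
    rw [eLpNorm_exponent_top] at hR
    exact (toReal_enorm (uncurry u z)) ▸ ENNReal.toReal_mono hR.ne hz
  have hcont : ContinuousOn (uncurry u) V :=
    (continuousOn_uncurry hsol).mono fun z hz => ⟨⟨hδ.le.trans hz.1.1.le, hz.1.2⟩, mem_univ _⟩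
  have hall := norm_le_of_ae_restrict_of_continuousOn hVo hcont hae
  refine ⟨R, M, fun t ht x hx => hall (t, x) ⟨ht, ?_⟩⟩
  rw [mem_compl_iff, mem_closedBall, dist_zero_right, not_le]
  exact hx

/-! ### Step 5: the near field and the reduction -/

/-- **Near-field bound**: if `u` is continuous on `[0, T) × ℝ³` and backward bounded at every
point `(T, x₀)` of the final slice, then `u` is bounded on `([δ, T) × B̄(0, R))` for every
`δ > 0` (compactness of `[δ, T] × B̄(0, R)`). [folklore] -/
theorem nearField_bound (hT : 0 < T)
    (hu : ContinuousOn (uncurry u) (Ico 0 T ×ˢ (univ : Set (EuclideanSpace ℝ (Fin 3)))))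
    (htop : ∀ x₀ : (EuclideanSpace ℝ (Fin 3)), IsBackwardBoundedAt u T x₀) {δ : ℝ} (hδ : 0 < δ)
    (R : ℝ) :
    ∃ M : ℝ, ∀ z ∈ Icc δ T ×ˢ closedBall (0 : (EuclideanSpace ℝ (Fin 3))) R,
      z.1 < T → ‖u z.1 z.2‖ ≤ M := by
  set K : Set (ℝ × (EuclideanSpace ℝ (Fin 3))) :=
    Icc δ T ×ˢ closedBall (0 : (EuclideanSpace ℝ (Fin 3))) R with hK
  have hKc : IsCompact K := isCompact_Icc.prod (isCompact_closedBall _ _)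
  refine hKc.induction_on (p := fun A => ∃ M : ℝ, ∀ z ∈ A, z.1 < T → ‖u z.1 z.2‖ ≤ M)
    ?_ ?_ ?_ ?_
  · exact ⟨0, fun z hz => hz.elim⟩
  · rintro A B hAB ⟨M, hM⟩
    exact ⟨M, fun z hz => hM z (hAB hz)⟩
  · rintro A B ⟨M, hM⟩ ⟨M', hM'⟩
    refine ⟨max M M', ?_⟩
    rintro z (hA | hB) hzT
    · exact (hM z hA hzT).trans (le_max_left _ _)
    · exact (hM' z hB hzT).trans (le_max_right _ _)
  · rintro ⟨t₀, x₀⟩ ⟨⟨ht₀δ, ht₀T⟩, -⟩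
    have ht₀ : 0 < t₀ := hδ.trans_le ht₀δ
    rcases lt_or_eq_of_le ht₀T with hlt | rfl
    · -- interior time: a compact box inside `[0, T) × ℝ³`
      set B : Set (ℝ × (EuclideanSpace ℝ (Fin 3))) :=
        Icc (t₀ / 2) ((t₀ + T) / 2) ×ˢ closedBall x₀ 1 with hB
      have hBc : IsCompact B := isCompact_Icc.prod (isCompact_closedBall _ _)
      have hBsub : B ⊆ Ico 0 T ×ˢ (univ : Set (EuclideanSpace ℝ (Fin 3))) := by
        rintro ⟨t, x⟩ ⟨⟨ht1, ht2⟩, -⟩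
        exact ⟨⟨by linarith, by linarith⟩, mem_univ _⟩
      obtain ⟨M, hM⟩ := hBc.exists_bound_of_continuousOn (hu.mono hBsub)
      set U : Set (ℝ × (EuclideanSpace ℝ (Fin 3))) :=
        Ioo (t₀ / 2) ((t₀ + T) / 2) ×ˢ ball x₀ 1 with hU
      have hUo : IsOpen U := isOpen_Ioo.prod isOpen_ball
      have hzU : ((t₀, x₀) : ℝ × (EuclideanSpace ℝ (Fin 3))) ∈ U :=
        ⟨⟨by linarith, by linarith⟩, mem_ball_self one_pos⟩
      refine ⟨U, mem_nhdsWithin_of_mem_nhds (hUo.mem_nhds hzU), M, fun z hz _ => ?_⟩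
      exact hM z ⟨⟨hz.1.1.le, hz.1.2.le⟩, ball_subset_closedBall hz.2⟩
    · -- final time: the local fact
      obtain ⟨r, hr, C, hC⟩ := htop x₀
      set U : Set (ℝ × (EuclideanSpace ℝ (Fin 3))) := Ioo (t₀ - r ^ 2) (t₀ + 1) ×ˢ ball x₀ r with hU
      have hUo : IsOpen U := isOpen_Ioo.prod isOpen_ball
      have hzU : ((t₀, x₀) : ℝ × (EuclideanSpace ℝ (Fin 3))) ∈ U :=
        ⟨⟨by nlinarith, by linarith⟩, mem_ball_self hr⟩
      refine ⟨U, mem_nhdsWithin_of_mem_nhds (hUo.mem_nhds hzU), C, fun z hz hzT => ?_⟩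
      exact hC z.1 ⟨hz.1.1, hzT⟩ z.2 hz.2

/-- **Seregin–Šverák 2002, global form from the local form.** The named fact
`seregin_sverak_2002` (boundedness of `u` on `(δ, T) × ℝ³` under a one-sided bound on the
normalised pressure or on the Bernoulli head) follows from the named fact
`SereginSverak2002_pressureOneSidedBound` (no singular point in `(0, T] × ℝ³`, backward
boundedness at every point): near field by compactness and the local fact at the final slice,
far field by the ε-regularity criterion (Lemarié-Rieusset 2016, Thm. 14.4, proved in the tree)
and the tails of `∫∫ (|u|³ + |p̃|^{3/2})` — the passage (3.5) ⇒ (3.6) of Escauriaza–Seregin–Šverák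
2003, §3, for the present criterion. Real proof; the local fact is the only hypothesis.
[cite: SereginSverak2002, main theorem (abstract); EscauriazaSereginSverak2003, §3 (3.5)–(3.6)] -/
theorem _root_.Literature.Analysis.FluidPDE.seregin_sverak_2002_of_pressureOneSidedBound
    (hX : SereginSverak2002_pressureOneSidedBound) : seregin_sverak_2002 := by
  intro ν T hν hT u p hsol hLH h₀ hone δ hδ
  -- the local form: no singular point in `(0, T] × ℝ³`
  have hone' : ∃ M : ℝ,
      (∀ t ∈ Ioo 0 T, ∀ x : (EuclideanSpace ℝ (Fin 3)), -M ≤ normalisedPressure (u t) x) ∨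
      (∀ t ∈ Ioo 0 T, ∀ x : (EuclideanSpace ℝ (Fin 3)),
        ‖u t x‖ ^ 2 + 2 * normalisedPressure (u t) x ≤ M) := by
    rcases hone with ⟨K, hK⟩ | ⟨K, hK⟩
    · refine ⟨2 * K, Or.inr fun t ht x => ?_⟩
      have := hK t ht x
      linarith
    · exact ⟨K, Or.inl hK⟩
  have hloc : ∀ t₀ ∈ Ioc 0 T, ∀ x₀ : (EuclideanSpace ℝ (Fin 3)), IsBackwardBoundedAt u t₀ x₀ :=
    hX ν T hν hT u p hsol hLH h₀ hone'
  -- far field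
  obtain ⟨R, M₁, hfar⟩ := farField_bound hν hT hsol hLH hδ.1
  -- near field
  obtain ⟨M₂, hnear⟩ := nearField_bound hT (continuousOn_uncurry hsol)
    (fun x₀ => hloc T ⟨hT, le_rfl⟩ x₀) hδ.1 R
  refine ⟨max M₁ M₂, fun t ht x => ?_⟩
  by_cases hx : ‖x‖ ≤ R
  · exact (hnear (t, x) ⟨⟨ht.1.le, ht.2.le⟩, mem_closedBall_zero_iff.2 hx⟩ ht.2).trans
      (le_max_right _ _)
  · exact (hfar t ht x (not_le.1 hx)).trans (le_max_left _ _)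


/-- **Conversely, the global form gives the local form**: a bound on `(δ, T) × ℝ³` for every
`δ ∈ (0, T)` is in particular a bound on the backward cylinder `(t₀ - r², t₀) × B(x₀, r)` with
`r² ≤ t₀/2`, for every `0 < t₀ ≤ T`. So the two renderings of the printed theorem in the tree are
equivalent (`seregin_sverak_2002_iff_pressureOneSidedBound`).
[cite: SereginSverak2002, main theorem (abstract)] -/
theorem _root_.Literature.Analysis.FluidPDE.SereginSverak2002_pressureOneSidedBound_of_global
    (h : seregin_sverak_2002) : SereginSverak2002_pressureOneSidedBound := by
  intro ν T hν hT u p hsol hLH h₀ hone t₀ ht₀ x₀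
  have hone' : (∃ K : ℝ, ∀ t ∈ Ioo 0 T, ∀ x, ‖u t x‖ ^ 2 / 2 + normalisedPressure (u t) x ≤ K) ∨
      (∃ K : ℝ, ∀ t ∈ Ioo 0 T, ∀ x, -K ≤ normalisedPressure (u t) x) := by
    obtain ⟨M, hM | hM⟩ := hone
    · exact Or.inr ⟨M, hM⟩
    · refine Or.inl ⟨M / 2, fun t ht x => ?_⟩
      have := hM t ht x
      linarith
  have hδ : t₀ / 2 ∈ Ioo 0 T := ⟨by linarith [ht₀.1], by linarith [ht₀.2]⟩
  obtain ⟨M, hM⟩ := h ν T hν hT u p hsol hLH h₀ hone' (t₀ / 2) hδ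
  set r : ℝ := Real.sqrt (t₀ / 2) with hr
  have hr0 : 0 < r := Real.sqrt_pos.2 (by linarith [ht₀.1])
  have hr2 : r ^ 2 = t₀ / 2 := Real.sq_sqrt (by linarith [ht₀.1])
  refine ⟨r, hr0, M, fun t ht x _ => hM t ⟨?_, ht.2.trans_le ht₀.2⟩ x⟩
  rw [hr2] at ht
  linarith [ht.1]

/-- **The two tree renderings of Seregin–Šverák 2002 are equivalent**: the global form
`seregin_sverak_2002` (boundedness on `(δ, T) × ℝ³`) and the local form
`SereginSverak2002_pressureOneSidedBound` (backward boundedness at every point of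
`(0, T] × ℝ³`). [cite: SereginSverak2002, main theorem (abstract)] -/
theorem _root_.Literature.Analysis.FluidPDE.seregin_sverak_2002_iff_pressureOneSidedBound :
    seregin_sverak_2002 ↔ SereginSverak2002_pressureOneSidedBound :=
  ⟨SereginSverak2002_pressureOneSidedBound_of_global, seregin_sverak_2002_of_pressureOneSidedBound⟩

end SereginSverak2002

end Literature.Analysis.FluidPDE

end
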